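import Literature.MathematicalPhysics.QuantumFieldTheory.Balaban1983to89.B1Ineq226RegularRegion
import Literature.MathematicalPhysics.QuantumFieldTheory.Balaban1983to89.B1Ineq224RegularRegion

/-!
# `Balaban1983to89.B1Ineq226HolderRegularRegion` — [Balaban1982Higgs1] Prop. 2.1 (2.26) WITH (2.24) p. 610–611: THE `δG_k(Ω, Ω₀, A)` CLAUSE,
# HÖLDER MEMBER, FOR BIG-BLOCK REGIONS `Ω ⊆ Ω₀ ⊂ T_ε` UNDER `R₀` AT EVERY (2.23)-REGULAR FIELD ON THE (Higgs)₂,₃ CARRIER =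
# [Balaban1983RegularityDecay] Theorem p. 573 (1.11)–(1.12) with (1.9), carrier instance for regions: the two regimes of p. 578 — the cancellation
# of the two walk expansions with the HÖLDER PROBE (this seat's `B1Ineq226RegionChain.chain_region_diff_of_inputs_probe`) for `|x − x′| ≤ L^K`, the
# derivative member of the `δG` clause (`B1Ineq226RegularRegion.deltaG_region_reg_decay`) beyond

statement-level skeleton of published theorems with citation tags; proofs where landed; nothing here is a claim about the Yang–Mills mass gap

PDF held: `paper:balaban1982-cmp85-higgs23-i` pp. 610–611 [PDF 8–9]; `paper:balaban1983-cmp89-regularity-decay` pp. 573, 578–579 [PDF 3, 8–9];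
pp. 578–579 read on the ×2 renders `pub-balaban/b2b-balaban-ref1/pages/1983-cmp89-regularity-decay/…-p008-x2.png`, `…-p009-x2.png`.

CITATION HEADER (lean-in-tree rule).  T. Bałaban, *(Higgs)₂,₃ quantum fields in a finite volume. I. A lower bound*, Commun. Math. Phys. **85**
(1982) 603–626 [Balaban1982Higgs1] (Prop. 2.1 (2.23), (2.24), (2.26) pp. 610–611) and T. Bałaban, *Regularity and decay of lattice Green's
functions*, Commun. Math. Phys. **89** (1983) 571–597 [Balaban1983RegularityDecay] (Theorem p. 573 (1.9), (1.11)–(1.12); proof pp. 578–579).  Cell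
`lit-balaban` (HOME `run/shared/lean/pub/lit-balaban/`), Phase-2 proof seat **p35** gen 13 (unit `lit-balaban-p35`); SKELETON rows **B1.Prop2.1** /
**B1.Eq2.26** (REGIONS of `T_ε`, concrete carrier, every (2.23)-regular `A`) and **B4.Thm@573** ((1.11)–(1.12) with (1.9), carrier model instance).
USED BY NAME, never restated: this lineage's `B1Ineq226RegionChain.chain_region_diff_of_inputs_probe`, `B1Ineq226RegularRegion.{deltaG_region_reg_decay,
exists_sum_le_of_geometric, covDeriv_sub', covDeriv_eq_zero_of_vanish}`, `B1Ineq224RegularRegion.cube_input_holder_reg_on`, `B1Ineq225RegularRegion`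
(`abs_acT_sub_le_of_reg_on`, `lpT_two_le_of_blockK`, `bOp_of_good`, `Gloc_of_good`, `rS_le_real`, `blockPiece`, `sum_blockPiece`),
`B1Ineq225DerivRegularRegion` (`cube_deriv_sup`, `norm_covDeriv_tail_le`, `covDeriv_add'`, `covDeriv_zero'`, `covDeriv_sum'`),
`B1TorusCubeLpInput.cube_inputs_lp`, `B1Lemma21RegularRegion.sNorm_bOp_le_of_bad`, gen 10's `B1TorusCubeHolderProbe.norm_probe_hsmul_le`,
`B1TorusChainTransport.{IsTChain, hol, norm_hol_apply}`, `eight_rS_le`, r14's `tdist_blockIter_le_real`, `sum_exp_neg_tdist_le`.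

WHAT IS PRINTED.  [B1] p. 610–611: *«|x − x′|^{−α}|U(A(Γ_{x,x′}))(D^η_{A,μ}G_k(Ω, A)f)(x′) − (D^η_{A,μ}G_k(Ω, A)f)(x)| ≤ c₀ exp(−δ₀ dist({x, x′}, supp f))‖f‖_∞
(2.24) for x, x′ ∈ Ω and satisfying the condition dist({x, x′}, Ω^c) ≥ R₀. … If Ω ⊂ Ω₀, then for δG_k(Ω, Ω₀, A) defined by the equality
δG_k(Ω, Ω₀, A) = G_k(Ω, A) − G_k(Ω₀, A), (2.26) we have the inequalities (2.24), (2.25) with the additional factor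
exp(−δ₀ dist(supp f, Ω^c) − δ₀ dist({x, x′}, Ω^c)) on the right sides.»*  [B4] p. 578: *«If |x′ − x| > 1, then this inequality is a simple
consequence of the corresponding inequality for the derivative only, hence we can assume |x′ − x| ≤ 1.»*

WHAT THIS FILE PROVES (kernel-checked, zero `sorry`; theorems only, no definition, no `Prop` fact).
* §1 private bookkeeping (`one_le_tdist_of_ne`, `gammaT_le`: `γ_T ≤ C_near(t/n)^α(L^Kε)`, as in `B1Ineq224RegularRegion`).
* §2 **`holder_deltaG_region_reg_decay`** — THE `δG` CLAUSE (2.26) WITH (2.24), HÖLDER MEMBER, FOR BIG-BLOCK REGIONS `Ω ⊆ Ω₀ ⊂ T_ε` UNDER `R₀` AT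
  EVERY FIELD (2.23)-REGULAR ON `Ω₀`, `g` in a `K`-block: a cube-size threshold `K₀min` chosen BEFORE `α`, and for every `0 ≤ α < 1` a constant
  `c₀ > 0` and per `K₀ ≥ K₀min` a threshold `e₁ > 0` such that … for sites `x′ ≠ x` with `{|y − x| ≤ 2rS + 2M(d+1) + 1}`, `{|y − x′| ≤ …} ⊂ Ω`,
  a nearest-neighbour chain `Γ` from `x` to `x′` with `|Γ| ≤ d|x − x′|`, `g` with `‖g‖_∞ ≤ M′` vanishing within `D` of `x` and of `x′`, `x, x′` at
  distance `≥ D₀` and `supp g` at distance `≥ D₁` from `Ω^c`: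
  `(|x − x′|/L^K)^{−α}·‖U(A(Γ))(D^ε_A δG g)(⟨x′, μ⟩) − (D^ε_A δG g)(⟨x, μ⟩)‖ ≤ c₀(L^Kε)·exp(−(D + D₀ + D₁)/(4K₀L^K))·M′`,
  `δG g = G^ε_K(Ω, A)1_Ωg − G^ε_K(Ω₀, A)1_{Ω₀}g`.
* §3 **`holder_deltaG_region_reg_decay_sum`** — the same for ARBITRARY `g`, rate `1/(8K₀L^K)`, `c₀(K₀)`.
HONEST SCOPE.  Operator form (not the kernel form); `Ω ⊆ Ω₀` big-block unions of one torus; `R₀` in site form around `x` and `x′` with respect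
to `Ω`; (2.23) assumed on `Ω₀`; constants not optimised.  Unit `lit-balaban-p35` gen 13 (literature-prover-lit-balaban-p35-g13-0).
-/

open scoped BigOperators

noncomputable section

namespace Literature.MathematicalPhysics.QuantumFieldTheory.Balaban1983to89.B1Ineq226HolderRegularRegion

open Literature.MathematicalPhysics.QuantumFieldTheory.Balaban1983to89.HiggsLattice
open Literature.MathematicalPhysics.QuantumFieldTheory.Balaban1983to89.HiggsAveraging
open Literature.MathematicalPhysics.QuantumFieldTheory.Balaban1983to89.HiggsCovariance
open Literature.MathematicalPhysics.QuantumFieldTheory.Balaban1983to89.HiggsCovariancePos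
open Literature.MathematicalPhysics.QuantumFieldTheory.Balaban1983to89.HiggsCovarianceCont (sNorm sNorm_nonneg sNorm_smul)
open Literature.MathematicalPhysics.QuantumFieldTheory.Balaban1983to89.B1TorusCubeCover
open Literature.MathematicalPhysics.QuantumFieldTheory.Balaban1983to89.B1TorusCubeLocality26 (rS cubeVec rS_succ_lt_half)
open Literature.MathematicalPhysics.QuantumFieldTheory.Balaban1983to89.B1TorusCubeChart (dd dd_succ castD toT M2 predL_succ)
open Literature.MathematicalPhysics.QuantumFieldTheory.Balaban1983to89.B1TorusCubeBoxOp (acT)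
open Literature.MathematicalPhysics.QuantumFieldTheory.Balaban1983to89.B1TorusCubeHolderProbe (norm_probe_hsmul_le)
open Literature.MathematicalPhysics.QuantumFieldTheory.Balaban1983to89.B1TorusChainTransport (IsTChain hol norm_hol_apply)
open Literature.MathematicalPhysics.QuantumFieldTheory.Balaban1983to89.B4GaugeCovariance (pathEnd)
open Literature.MathematicalPhysics.QuantumFieldTheory.Balaban1983to89.B4Lower18Regular (e1)
open Literature.MathematicalPhysics.QuantumFieldTheory.Balaban1983to89.B4Lemma22EtaBox (vol vol_pos)
open Literature.MathematicalPhysics.QuantumFieldTheory.Balaban1983to89.B4PartitionUnity22 (hprof D1 D2 D1_nonneg D2_nonneg contDiff_hprof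
  hasCompactSupport_hprof)
open Literature.MathematicalPhysics.QuantumFieldTheory.Balaban1983to89.B1TorusRegionCubes
open Literature.MathematicalPhysics.QuantumFieldTheory.Balaban1983to89.B1TorusRegionHSizes (IsBigBlockUnion blockSat_of_isBigBlockUnion)
open Literature.MathematicalPhysics.QuantumFieldTheory.Balaban1983to89.B1TorusRegionRop
open Literature.MathematicalPhysics.QuantumFieldTheory.Balaban1983to89.B1TorusLabelWalk
open Literature.MathematicalPhysics.QuantumFieldTheory.Balaban1983to89.B1Lemma21RegularRegion (sNorm_bOp_le_of_bad)
open Literature.MathematicalPhysics.QuantumFieldTheory.Balaban1983to89.B1TorusCubeLpInput (lpT lpT_def lpT_nonneg cube_inputs_lp)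
open Literature.MathematicalPhysics.QuantumFieldTheory.Balaban1983to89.B1Ineq225RegionChain
open Literature.MathematicalPhysics.QuantumFieldTheory.Balaban1983to89.B1Ineq225RegularRegion
open Literature.MathematicalPhysics.QuantumFieldTheory.Balaban1983to89.B1Ineq225DerivRegularRegion
open Literature.MathematicalPhysics.QuantumFieldTheory.Balaban1983to89.B1Ineq226RegionChain (chain_region_diff_of_inputs_probe)
open Literature.MathematicalPhysics.QuantumFieldTheory.Balaban1983to89.B1Ineq226RegularRegion (deltaG_region_reg_decay exists_sum_le_of_geometric
  covDeriv_sub' covDeriv_eq_zero_of_vanish)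
open Literature.MathematicalPhysics.QuantumFieldTheory.Balaban1983to89.B1Ineq224RegularRegion (cube_input_holder_reg_on)
open Literature.MathematicalPhysics.QuantumFieldTheory.Balaban1983to89.B1Ineq225DecayBackgroundTorus (tdist_le_of_near eight_rS_le)
open Literature.MathematicalPhysics.QuantumFieldTheory.Balaban1983to89.B1Ineq234LevelZero (tdist_triangle_real tdist_shift_le_one)
open Literature.MathematicalPhysics.QuantumFieldTheory.Balaban1983to89.B1Ineq234Concrete (tdist_blockIter_le_real)
open Literature.MathematicalPhysics.QuantumFieldTheory.Balaban1983to89.B2Eq230CondShiftBound (sum_exp_neg_tdist_le)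
open Literature.MathematicalPhysics.QuantumFieldTheory.Balaban1983to89.B4Sect5Proof (latticeConst latticeConst_nonneg)

variable {P : HiggsLattice.Params} {N : ℕ}

/-! ## §1 Bookkeeping -/

section Helpers

/-- distinct torus sites are at (1.3)-distance at least one lattice unit. [cite: Balaban1982Higgs1, (1.3) p.604] -/
private theorem one_le_tdist_of_ne {k : ℕ} {x x' : HiggsLattice.Site P k} (h : x' ≠ x) : 1 ≤ HiggsLattice.Site.tdist x x' := by
  obtain ⟨μ, hμ⟩ : ∃ μ, x' μ ≠ x μ := by
    by_contra hc
    push Not at hc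
    exact h (funext hc)
  unfold HiggsLattice.Site.tdist
  refine le_trans ?_ (Finset.le_sup (f := fun ν : Fin P.d => min (x ν - x' ν).val (x' ν - x ν).val) (Finset.mem_univ μ))
  refine le_min ?_ ?_
  · exact Nat.one_le_iff_ne_zero.2 fun h0 => hμ (sub_eq_zero.1 ((ZMod.val_eq_zero _).1 h0)).symm
  · exact Nat.one_le_iff_ne_zero.2 fun h0 => hμ (sub_eq_zero.1 ((ZMod.val_eq_zero _).1 h0))

/-- the near-regime bookkeeping: `γ_T ≤ C_near·(t/n)^α·(L^Kε)` for `1 ≤ t ≤ n`, `|Γ| ≤ dt`, `K₀ ≥ 8`. [folklore] -/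
private theorem gammaT_le {Pd K₀ : ℕ} (hK₀8 : 8 ≤ K₀) {D₁ D₂ CH Cδ Cγ t n m0 ℓ α : ℝ} (hD₁ : 0 ≤ D₁) (hD₂ : 0 ≤ D₂)
    (hCδ : 0 ≤ Cδ) (hCγ : 0 ≤ Cγ) (hn : 0 < n) (hm0 : 0 < m0) (ht1 : 1 ≤ t) (htn : t ≤ n) (hℓ0 : 0 ≤ ℓ)
    (hℓ : ℓ ≤ (Pd : ℝ) * t) (hα1 : α < 1) :
    CH * (t / n) ^ α * (n * m0) + (Pd : ℝ) * (D₁ + D₂) / (K₀ : ℝ) * ((2 * ℓ + 2) / n) * (Cδ * (n * m0))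
        + (D₁ ^ 2 + D₂) / (K₀ : ℝ) ^ 2 * ((Pd : ℝ) * ℓ / (n ^ 2 * m0)) * (Cγ * (n * m0) ^ 2)
      ≤ (CH + (Pd : ℝ) * (D₁ + D₂) / 8 * (2 * (Pd : ℝ) + 2) * Cδ + (D₁ ^ 2 + D₂) / 64 * (Pd : ℝ) ^ 2 * Cγ) * (t / n) ^ α * (n * m0) := by
  have hK₀r : (8 : ℝ) ≤ K₀ := by exact_mod_cast hK₀8
  have ht0 : 0 < t := lt_of_lt_of_le one_pos ht1
  have hq0 : 0 < t / n := div_pos ht0 hn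
  have hq1 : t / n ≤ 1 := (div_le_one hn).2 htn
  set w : ℝ := (t / n) ^ α with hw
  have hqw : t / n ≤ w := by
    have h := Real.rpow_le_rpow_of_exponent_ge hq0 hq1 hα1.le
    rwa [Real.rpow_one] at h
  have hw0 : 0 ≤ w := Real.rpow_nonneg hq0.le α
  have hPd : (0 : ℝ) ≤ Pd := Nat.cast_nonneg _
  have h2a : (Pd : ℝ) * (D₁ + D₂) / (K₀ : ℝ) ≤ (Pd : ℝ) * (D₁ + D₂) / 8 :=
    div_le_div_of_nonneg_left (by positivity) (by norm_num) hK₀r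
  have h2b : (2 * ℓ + 2) / n ≤ (2 * (Pd : ℝ) + 2) * w := by
    have h1 : 2 * ℓ + 2 ≤ (2 * (Pd : ℝ) + 2) * t := by nlinarith
    calc (2 * ℓ + 2) / n ≤ (2 * (Pd : ℝ) + 2) * t / n := div_le_div_of_nonneg_right h1 hn.le
      _ = (2 * (Pd : ℝ) + 2) * (t / n) := by ring
      _ ≤ (2 * (Pd : ℝ) + 2) * w := mul_le_mul_of_nonneg_left hqw (by positivity)
  have h2 : (Pd : ℝ) * (D₁ + D₂) / (K₀ : ℝ) * ((2 * ℓ + 2) / n) * (Cδ * (n * m0))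
      ≤ (Pd : ℝ) * (D₁ + D₂) / 8 * ((2 * (Pd : ℝ) + 2) * w) * (Cδ * (n * m0)) := by
    have h2c : 0 ≤ (2 * ℓ + 2) / n := by positivity
    gcongr
  have h3a : (D₁ ^ 2 + D₂) / (K₀ : ℝ) ^ 2 ≤ (D₁ ^ 2 + D₂) / 64 :=
    div_le_div_of_nonneg_left (by positivity) (by norm_num) (by nlinarith)
  have h3e : (D₁ ^ 2 + D₂) / (K₀ : ℝ) ^ 2 * ((Pd : ℝ) * ℓ / (n ^ 2 * m0)) * (Cγ * (n * m0) ^ 2)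
      = (D₁ ^ 2 + D₂) / (K₀ : ℝ) ^ 2 * ((Pd : ℝ) * ℓ) * (Cγ * m0) := by
    field_simp
  have h3b : (Pd : ℝ) * ℓ ≤ (Pd : ℝ) ^ 2 * w * n := by
    calc (Pd : ℝ) * ℓ ≤ (Pd : ℝ) * ((Pd : ℝ) * t) := mul_le_mul_of_nonneg_left hℓ hPd
      _ = (Pd : ℝ) ^ 2 * (t / n) * n := by field_simp
      _ ≤ (Pd : ℝ) ^ 2 * w * n := by gcongr
  have h3 : (D₁ ^ 2 + D₂) / (K₀ : ℝ) ^ 2 * ((Pd : ℝ) * ℓ / (n ^ 2 * m0)) * (Cγ * (n * m0) ^ 2)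
      ≤ (D₁ ^ 2 + D₂) / 64 * ((Pd : ℝ) ^ 2 * w * n) * (Cγ * m0) := by
    rw [h3e]
    have : 0 ≤ (Pd : ℝ) * ℓ := by positivity
    gcongr
  calc CH * (t / n) ^ α * (n * m0) + (Pd : ℝ) * (D₁ + D₂) / (K₀ : ℝ) * ((2 * ℓ + 2) / n) * (Cδ * (n * m0))
        + (D₁ ^ 2 + D₂) / (K₀ : ℝ) ^ 2 * ((Pd : ℝ) * ℓ / (n ^ 2 * m0)) * (Cγ * (n * m0) ^ 2)
      ≤ CH * w * (n * m0) + (Pd : ℝ) * (D₁ + D₂) / 8 * ((2 * (Pd : ℝ) + 2) * w) * (Cδ * (n * m0))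
        + (D₁ ^ 2 + D₂) / 64 * ((Pd : ℝ) ^ 2 * w * n) * (Cγ * m0) := by rw [hw]; linarith
    _ = (CH + (Pd : ℝ) * (D₁ + D₂) / 8 * (2 * (Pd : ℝ) + 2) * Cδ + (D₁ ^ 2 + D₂) / 64 * (Pd : ℝ) ^ 2 * Cγ) * w * (n * m0) := by
        ring

/-- the three-distance exponent bookkeeping: a numerator `≥ Σ − 2` costs at most `e³` (`M ≥ 1`, `rS ≤ 3M/4`). [folklore] -/
private theorem exp_shift_le {S Sg r h : ℝ} (hh1 : 1 ≤ h) (hr : r ≤ 3 / 4 * h) (hS : Sg - 2 ≤ S) :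
    Real.exp (-((S - 8 * r - 4 * h) / (4 * h))) ≤ Real.exp 3 * Real.exp (-(Sg / (4 * h))) := by
  rw [← Real.exp_add]
  refine Real.exp_le_exp.2 ?_
  have hh0 : 0 < 4 * h := by linarith
  have e2 : (S - 8 * r - 4 * h) / (4 * h) - Sg / (4 * h) = (S - Sg - 8 * r - 4 * h) / (4 * h) := by ring
  have h5 : -(3 : ℝ) ≤ (S - Sg - 8 * r - 4 * h) / (4 * h) := by
    rw [le_div_iff₀ hh0]
    linarith
  linarith

/-- `⌈D⌉ − 1 + ⌈D₀⌉ − 1 + ⌈D₁⌉ ≥ D + D₀ + D₁ − 2` (natural-number truncation included). [folklore] -/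
private theorem sum_ceil_ge (D D₀ D₁ : ℝ) : D + D₀ + D₁ - 2 ≤ ((((⌈D⌉₊ - 1) + (⌈D₀⌉₊ - 1) + ⌈D₁⌉₊ : ℕ)) : ℝ) := by
  have hceil1 : ∀ s : ℝ, s - 1 ≤ (((⌈s⌉₊ - 1 : ℕ)) : ℝ) := by
    intro s
    have hs : s ≤ (⌈s⌉₊ : ℝ) := Nat.le_ceil s
    rcases Nat.eq_zero_or_pos ⌈s⌉₊ with h0 | hpos
    · rw [h0]; simp; linarith [show (⌈s⌉₊ : ℝ) = 0 by exact_mod_cast h0]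
    · rw [Nat.cast_sub hpos, Nat.cast_one]; linarith
  push_cast
  linarith [hceil1 D, hceil1 D₀, Nat.le_ceil D₁]

/-- the smallness `d²·c·e_K^β ≤ 1/3` from `e_K ≤ (3(d²c + 1))^{−1/β}`. [folklore] -/
private theorem smallness_third {dr creg β ec : ℝ} (hcreg : 0 ≤ creg) (hβ : 0 < β) (hec : 0 < ec)
    (hle : ec ≤ ((3 * (dr ^ 2 * creg + 1))⁻¹) ^ β⁻¹) : dr ^ 2 * creg * ec ^ β ≤ 1 / 3 := by
  have hin : 0 < (3 * (dr ^ 2 * creg + 1))⁻¹ := by positivity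
  have h1 : ec ^ β ≤ (((3 * (dr ^ 2 * creg + 1))⁻¹) ^ β⁻¹) ^ β := Real.rpow_le_rpow hec.le hle hβ.le
  rw [Real.rpow_inv_rpow hin.le hβ.ne'] at h1
  have h3 : dr ^ 2 * creg * ec ^ β ≤ dr ^ 2 * creg * (3 * (dr ^ 2 * creg + 1))⁻¹ :=
    mul_le_mul_of_nonneg_left h1 (by positivity)
  refine h3.trans ?_
  rw [← div_eq_mul_inv, div_le_div_iff₀ (by positivity) (by norm_num)]
  nlinarith [sq_nonneg dr, mul_nonneg (sq_nonneg dr) hcreg]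

/-- `3^dβ ≤ e⁻¹ ⇒ 2^dβ < 1`. [folklore] -/
private theorem two_pow_mul_lt_one {d : ℕ} {β : ℝ} (hβ : 0 ≤ β) (hDβ : (3 : ℝ) ^ d * β ≤ Real.exp (-1)) : (2 : ℝ) ^ d * β < 1 := by
  have h1 : (2 : ℝ) ^ d ≤ 3 ^ d := pow_le_pow_left₀ (by norm_num) (by norm_num) _
  have h2 : Real.exp (-1) < 1 := Real.exp_lt_one_iff.2 (by norm_num)
  nlinarith [mul_le_mul_of_nonneg_right h1 hβ]

/-- the letter constant `C_m/K₀` is small: `3^d·C_m·e ≤ K₀ ⇒ 3^d·(C_m/K₀) ≤ e⁻¹`. [folklore] -/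
private theorem letter_small {d : ℕ} {Cm K₀r : ℝ} (hK₀r : 0 < K₀r) (hK₀C : (3 : ℝ) ^ d * Cm * Real.exp 1 ≤ K₀r) :
    (3 : ℝ) ^ d * (Cm / K₀r) ≤ Real.exp (-1) := by
  rw [mul_div_assoc', div_le_iff₀ hK₀r]
  have h1 : Real.exp (-1) * Real.exp 1 = 1 := by rw [← Real.exp_add]; norm_num
  have h2 : (3 : ℝ) ^ d * Cm = (3 : ℝ) ^ d * Cm * Real.exp 1 * Real.exp (-1) := by
    rw [mul_assoc ((3 : ℝ) ^ d * Cm), mul_comm (Real.exp 1), h1, mul_one]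
  rw [h2]
  exact mul_le_mul_of_nonneg_right hK₀C (Real.exp_pos _).le |>.trans_eq (mul_comm _ _)

end Helpers

/-! ## §2 The `δG` clause, Hölder member, for big-block regions `Ω ⊆ Ω₀` under `R₀`: the two regimes of p. 578 -/

section Main

set_option maxHeartbeats 2400000 in
/-- **PROP. 2.1 (2.26) WITH (2.24), HÖLDER MEMBER OF THE `δG` CLAUSE, FOR BIG-BLOCK REGIONS `Ω ⊆ Ω₀ ⊂ T_ε` UNDER `R₀`, AT EVERY VECTOR FIELD
(2.23)-REGULAR ON `Ω₀` — B4's THEOREM (1.11)–(1.12) WITH (1.9) FOR REGIONS ON THE CARRIER**, `g` supported in a `K`-block.  For `d ≥ 1`, `L ≥ 2`,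
`a > 0`, `m² > 0`, `N`, `(e, q)`, a mesh cap `ε₀` and a regularity pair `c ≥ 0`, `β > 0`: a cube-size threshold `K₀min` chosen BEFORE `α`, and
for every `0 ≤ α < 1` a constant `c₀ > 0` and per cube size `K₀ ≥ K₀min` a threshold `e₁ > 0` such that on EVERY torus of the carrier with `K₀ ∣ M`,
at every level `1 ≤ K ≤ K_P` with `3·L^KK₀ ≤ |T_ε|_μ`, `L^Kε ≤ ε₀`, for all big-block unions `Ω ⊆ Ω₀`, EVERY `A` and `0 < e_K ≤ e₁` with (2.23) on
`Ω₀`, every direction `μ`, sites `x′ ≠ x` with `{|y − x| ≤ 2rS + 2M(d+1) + 1} ⊂ Ω`, `{|y − x′| ≤ 2rS + 2M(d+1) + 1} ⊂ Ω`, a nearest-neighbour chain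
`Γ` from `x` to `x′` with `|Γ| ≤ d|x − x′|`, every `g` supported in a `K`-block with `‖g‖_∞ ≤ M′` vanishing at the sites within distance `< D` of `x`
and of `x′`, `x` and `x′` at distance `≥ D₀` from `Ω^c`, `supp g` at distance `≥ D₁` from `Ω^c` (`D, D₀, D₁ ≥ 0`): with
`δG g = G^ε_K(Ω, A)1_Ωg − G^ε_K(Ω₀, A)1_{Ω₀}g`,
`(|x − x′|/L^K)^{−α}·‖U(A(Γ))(D^ε_A δG g)(⟨x′, μ⟩) − (D^ε_A δG g)(⟨x, μ⟩)‖ ≤ c₀(L^Kε)·exp(−(D + D₀ + D₁)/(4K₀L^K))·M′`.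
Proof: `|x − x′| ≤ L^K` by `chain_region_diff_of_inputs_probe` with the Hölder probe at `X₀ = {x, x + e_μ, x′, x′ + e_μ}` (probe bound
`γ_T = C_near(|x − x′|/L^K)^α(L^Kε)` from `norm_probe_hsmul_le` fed by `cube_deriv_sup` and `cube_input_holder_reg_on`, room `K₀ ≥ 8d + 24`);
`|x − x′| > L^K` — «a simple consequence of the corresponding inequality for the derivative only» — from the derivative member of
`deltaG_region_reg_decay` at both bonds.
[cite: Balaban1982Higgs1, Prop. 2.1 (2.23), (2.24), (2.26) pp.610–611] [cite: Balaban1983RegularityDecay, Theorem (1.9), (1.11)–(1.12) p.573; pp.578–579] -/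
theorem holder_deltaG_region_reg_decay (d L : ℕ) (hd : 1 ≤ d) (hL : 2 ≤ L) {a : ℝ} (ha : 0 < a) {msq : ℝ} (hmsq : 0 < msq)
    (N : ℕ) (C : ChargeData N) (ε₀ : ℝ) (creg β : ℝ) (hcreg : 0 ≤ creg) (hβ : 0 < β) :
    ∃ K₀min : ℕ, ∀ {α : ℝ}, 0 ≤ α → α < 1 → ∃ c₀ : ℝ, 0 < c₀ ∧ ∀ K₀ : ℕ, K₀min ≤ K₀ → ∃ e₁ : ℝ, 0 < e₁ ∧
      ∀ (P : HiggsLattice.Params), P.d = d → P.L = L → K₀ ∣ P.M →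
      ∀ {K : ℕ}, 1 ≤ K → K ≤ P.K → (∀ μ, 3 * half P K K₀ ≤ P.sitesPerDir 0 μ) → P.mesh K ≤ ε₀ →
      ∀ (Ω Ω₀ : Finset (HiggsLattice.Site P 0)), IsBigBlockUnion K K₀ Ω → IsBigBlockUnion K K₀ Ω₀ → Ω ⊆ Ω₀ →
      ∀ (A : HiggsLattice.VecField P 0) {ec : ℝ}, 0 < ec → ec ≤ e₁ →
      (∀ z ∈ Ω₀, ∀ μ ν : Fin P.d,
          P.mesh K * |C.e| / ec * |A ⟨z.shift μ, ν⟩ - A ⟨z, ν⟩| ≤ creg * ec ^ (β - 1) / (P.L : ℝ) ^ K) →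
      ∀ (μ : Fin P.d) (x x' : HiggsLattice.Site P 0), x' ≠ x →
        (∀ y, HiggsLattice.Site.tdist x y ≤ 2 * rS P K K₀ + 2 * half P K K₀ * (P.d + 1) + 1 → y ∈ Ω) →
        (∀ y, HiggsLattice.Site.tdist x' y ≤ 2 * rS P K K₀ + 2 * half P K K₀ * (P.d + 1) + 1 → y ∈ Ω) →
        ∀ (l : List (HiggsLattice.Site P 0)), IsTChain x l → pathEnd x l = x' →
          (l.length : ℝ) ≤ (P.d : ℝ) * HiggsLattice.Site.tdist x x' →
        ∀ (y₀ : HiggsLattice.Site P 0) (g : HiggsLattice.ScalarField P 0 N) (M D D₀ D₁ : ℝ),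
          (∀ y, blockIter K y ≠ blockIter K y₀ → g y = 0) → (∀ y, ‖g y‖ ≤ M) → 0 ≤ D → 0 ≤ D₀ → 0 ≤ D₁ →
          (∀ z, g z ≠ 0 → D ≤ (HiggsLattice.Site.tdist x z : ℝ)) → (∀ z, g z ≠ 0 → D ≤ (HiggsLattice.Site.tdist x' z : ℝ)) →
          (∀ z, z ∉ Ω → D₀ ≤ (HiggsLattice.Site.tdist x z : ℝ)) → (∀ z, z ∉ Ω → D₀ ≤ (HiggsLattice.Site.tdist x' z : ℝ)) →
          (∀ y z, g y ≠ 0 → z ∉ Ω → D₁ ≤ (HiggsLattice.Site.tdist z y : ℝ)) →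
            (((HiggsLattice.Site.tdist x x' : ℝ) / (P.L : ℝ) ^ K)⁻¹) ^ α *
                ‖hol C A x l (covDeriv C A (propagatorK C Ω A msq a K (chi Ω • g) - propagatorK C Ω₀ A msq a K (chi Ω₀ • g)) ⟨x', μ⟩)
                  - covDeriv C A (propagatorK C Ω A msq a K (chi Ω • g) - propagatorK C Ω₀ A msq a K (chi Ω₀ • g)) ⟨x, μ⟩‖
              ≤ c₀ * P.mesh K * Real.exp (-((D + D₀ + D₁) / (4 * K₀ * (P.L : ℝ) ^ K))) * M := by
  have hℓ0 : 1 ≤ L - 1 := by omega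
  have hp₁ : (((d - 1 : ℕ)) : ℝ) + 1 < 2 * d := by
    rw [Nat.cast_sub hd, Nat.cast_one]
    have : (1 : ℝ) ≤ d := by exact_mod_cast hd
    linarith
  obtain ⟨Cγ, Cβ, hCγ, hCβ, hcube⟩ := cube_inputs_lp C (d - 1) (L - 1) hℓ0 a a (msq * ε₀ ^ 2) ha hp₁
  obtain ⟨Cγ', Cδ, CT, hCγ', hCδ, hCT, hderiv⟩ := cube_deriv_sup C (d - 1) (L - 1) hℓ0 ha hmsq (msq * ε₀ ^ 2) creg β hcreg hβ
  obtain ⟨c₉, hc₉, K₉, hfar⟩ := deltaG_region_reg_decay d L hd hL ha hmsq N C ε₀ creg β hcreg hβ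
  -- the boundary-piece constant of Lemma 2.1 (depends on `d, L, a` only)
  have hLr : (1 : ℝ) < L := by exact_mod_cast (show 1 < L by omega)
  set γ₀ : ℝ := min 2 (a * (1 - (((L : ℕ) : ℝ) ^ 2)⁻¹) / 4) with hγ₀
  have hγ₀pos : 0 < γ₀ := by
    have h1 : (((L : ℕ) : ℝ) ^ 2)⁻¹ < 1 := inv_lt_one_of_one_lt₀ (by nlinarith)
    exact lt_min (by norm_num) (by nlinarith [mul_pos ha (show (0 : ℝ) < 1 - (((L : ℕ) : ℝ) ^ 2)⁻¹ by linarith)])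
  set Cb : ℝ := ((((d - 1 : ℕ)) : ℝ) + 1) * (D1 hprof + D2 hprof) * (γ₀⁻¹ + 2 * Real.sqrt (d * γ₀⁻¹) + a * γ₀⁻¹) with hCb
  have hD1 := D1_nonneg contDiff_hprof hasCompactSupport_hprof
  have hD2 := D2_nonneg contDiff_hprof hasCompactSupport_hprof
  have hCb0 : 0 ≤ Cb := by
    have := inv_nonneg.2 hγ₀pos.le
    have := Real.sqrt_nonneg (d * γ₀⁻¹)
    positivity
  set Cm : ℝ := max Cβ Cb with hCm
  have hCm0 : 0 < Cm := lt_of_lt_of_le hCβ (le_max_left _ _)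
  -- the cube size is fixed BEFORE `α`
  refine ⟨max (max K₉ 8) (max ⌈(3 : ℝ) ^ d * Cm * Real.exp 1⌉₊ (8 * d + 24)), fun {α} hα0 hα1 => ?_⟩
  obtain ⟨CH, hCH, hhol⟩ := cube_input_holder_reg_on C (d - 1) (L - 1) hℓ0 ha hmsq (msq * ε₀ ^ 2) creg β hcreg hβ hα0 hα1
  set Cnear : ℝ := CH + (d : ℝ) * (D1 hprof + D2 hprof) / 8 * (2 * (d : ℝ) + 2) * Cδ + (D1 hprof ^ 2 + D2 hprof) / 64 * (d : ℝ) ^ 2 * Cγ'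
    with hCnear
  have hCnear0 : 0 < Cnear := by positivity
  refine ⟨16 * 2 ^ d * Cnear * Real.exp 3 + 2 * c₉, by positivity, fun K₀ hK₀ => ?_⟩
  have hK₀9 : K₉ ≤ K₀ := le_trans (le_trans (le_max_left _ _) (le_max_left _ _)) hK₀
  have hK₀8 : 8 ≤ K₀ := le_trans (le_trans (le_max_right _ _) (le_max_left _ _)) hK₀
  have hK₀r : (0 : ℝ) < K₀ := by exact_mod_cast lt_of_lt_of_le (by norm_num) hK₀8
  have hK₀C : (3 : ℝ) ^ d * Cm * Real.exp 1 ≤ K₀ :=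
    (Nat.le_ceil _).trans (by exact_mod_cast le_trans (le_trans (le_max_left _ _) (le_max_right _ _)) hK₀)
  have hK₀d : 8 * d + 24 ≤ K₀ := le_trans (le_trans (le_max_right _ _) (le_max_right _ _)) hK₀
  obtain ⟨e₁, he₁, hcubeK⟩ := hcube creg β hcreg hβ K₀ hK₀8
  obtain ⟨e₃, he₃, hderK⟩ := hderiv K₀ hK₀8
  obtain ⟨e₄, he₄, hholK⟩ := hhol K₀ hK₀8
  obtain ⟨e₉, he₉, hfarK⟩ := hfar K₀ hK₀9
  -- the smallness of `e_K` for Lemma 2.1 at the boundary pieces: `d²·c·e_K^β ≤ 1/3`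
  set es : ℝ := ((3 * ((d : ℝ) ^ 2 * creg + 1))⁻¹) ^ β⁻¹ with hes
  have hin : 0 < (3 * ((d : ℝ) ^ 2 * creg + 1))⁻¹ := by positivity
  have hes0 : 0 < es := Real.rpow_pos_of_pos hin _
  refine ⟨min (min (min e₁ es) e₃) (min e₄ e₉), lt_min (lt_min (lt_min he₁ hes0) he₃) (lt_min he₄ he₉), ?_⟩
  intro P hPd hPL hK₀M K hK1 hK hN3 hε Ω Ω₀ hΩ hΩ₀ hsub A ec hec hle' hreg μ x x' hne hRx hRx' l hch hend hlen y₀ g M D D₀ D₁ hg hgM hD0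
    hD₀0 hD₁0 hDx hDx' hxD₀ hx'D₀ hgD₁
  have hle : ec ≤ min e₁ es := hle'.trans ((min_le_left _ _).trans (min_le_left _ _))
  have hle3 : ec ≤ e₃ := hle'.trans ((min_le_left _ _).trans (min_le_right _ _))
  have hle4 : ec ≤ e₄ := hle'.trans ((min_le_right _ _).trans (min_le_left _ _))
  have hle9 : ec ≤ e₉ := hle'.trans ((min_le_right _ _).trans (min_le_right _ _))
  -- the far-regime tool: the derivative member of the `δG` clause at a bond whose source carries `R₀ + 1`, `D` and `D₀`
  have hfar' := fun (z : HiggsLattice.Site P 0)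
      (hRz : ∀ y, HiggsLattice.Site.tdist z y ≤ 2 * rS P K K₀ + 2 * half P K K₀ * (P.d + 1) + 1 → y ∈ Ω)
      (hDz : ∀ w, g w ≠ 0 → D ≤ (HiggsLattice.Site.tdist z w : ℝ))
      (hzD₀ : ∀ w, w ∉ Ω → D₀ ≤ (HiggsLattice.Site.tdist z w : ℝ)) =>
    (hfarK P hPd hPL hK₀M hK1 hK hN3 hε Ω Ω₀ hΩ hΩ₀ hsub A hec hle9 hreg z hRz y₀ g M D D₀ D₁ hg hgM hD0 hD₀0 hD₁0 hDz hzD₀ hgD₁).2 μ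
  subst hPd
  have hdd : dd P = P.d - 1 := rfl
  have hPL1 : P.L - 1 = L - 1 := by rw [hPL]
  have hL1 : 1 < P.L := by rw [hPL]; omega
  have hL1r : (1 : ℝ) < P.L := by exact_mod_cast hL1
  have hak : 0 ≤ B1.aSeq a P.L K := (B1.aSeq_pos ha hL1r hK1).le
  have hK₀' : 1 ≤ K₀ := le_trans (by norm_num) hK₀8
  have hmesh : 0 < P.mesh K := P.mesh_pos K
  have hmesh0 : 0 < P.mesh 0 := P.mesh_pos 0
  have hcap : msq * P.mesh K ^ 2 ≤ msq * ε₀ ^ 2 := mul_le_mul_of_nonneg_left (pow_le_pow_left₀ hmesh.le hε 2) hmsq.le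
  have hM0 : 0 ≤ M := (norm_nonneg _).trans (hgM x)
  have hgn : ‖g‖ ≤ M := (pi_norm_le_iff_of_nonneg hM0).2 hgM
  have hn0 : (0 : ℝ) < (P.L : ℝ) ^ K := by positivity
  set t : ℝ := (HiggsLattice.Site.tdist x x' : ℝ) with ht_def
  have ht1 : 1 ≤ t := by rw [ht_def]; exact_mod_cast one_le_tdist_of_ne hne
  have ht0 : 0 < t := lt_of_lt_of_le one_pos ht1
  have hq0 : 0 < t / (P.L : ℝ) ^ K := div_pos ht0 hn0
  set δG : HiggsLattice.ScalarField P 0 N := propagatorK C Ω A msq a K (chi Ω • g) - propagatorK C Ω₀ A msq a K (chi Ω₀ • g) with hδG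
  set Q : ℝ := ‖hol C A x l (covDeriv C A δG ⟨x', μ⟩) - covDeriv C A δG ⟨x, μ⟩‖ with hQ_def
  have hQ0 : 0 ≤ Q := norm_nonneg _
  set E : ℝ := Real.exp (-((D + D₀ + D₁) / (4 * K₀ * (P.L : ℝ) ^ K))) with hE_def
  have hE0 : 0 ≤ E := (Real.exp_pos _).le
  -- the exponent: numerator `≥ D + D₀ + D₁ − 2` costs at most `e³`
  have hh : (half P K K₀ : ℝ) = (P.L : ℝ) ^ K * K₀ := by unfold half; push_cast; ring
  have hhpos : (0 : ℝ) < half P K K₀ := by exact_mod_cast half_pos hK₀'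
  have hh1 : (1 : ℝ) ≤ half P K K₀ := by exact_mod_cast half_pos hK₀'
  have hrS := rS_le_real (P := P) (K := K) hK₀8
  have hexp : Real.exp (-((((((⌈D⌉₊ - 1) + (⌈D₀⌉₊ - 1) + ⌈D₁⌉₊ : ℕ)) : ℝ) - 8 * rS P K K₀ - 4 * half P K K₀) / (4 * half P K K₀)))
      ≤ Real.exp 3 * E := by
    have e1 : (D + D₀ + D₁) / (4 * K₀ * (P.L : ℝ) ^ K) = (D + D₀ + D₁) / (4 * half P K K₀) := by rw [hh]; ring_nf
    rw [hE_def, e1]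
    exact exp_shift_le hh1 hrS (sum_ceil_ge D D₀ D₁)
  by_cases hnt : HiggsLattice.Site.tdist x x' ≤ P.L ^ K
  · -- the regime `|x − x′| ≤ L^K`: the cancellation of the two walk expansions with the Hölder probe
    have htn : t ≤ (P.L : ℝ) ^ K := by rw [ht_def]; exact_mod_cast hnt
    have hroom : 4 * (rS P K K₀ + P.d * P.L ^ K + 2) ≤ 3 * half P K K₀ := by
      have h8 := eight_rS_le (P := P) (K := K) (K₀ := K₀)
      have hn1 : 1 ≤ P.L ^ K := Nat.one_le_pow K P.L P.hL
      have hh : P.L ^ K * (8 * P.d + 24) ≤ P.L ^ K * K₀ := Nat.mul_le_mul_left _ hK₀d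
      unfold half at h8 ⊢
      have e1 : P.L ^ K * (8 * P.d + 24) = 8 * (P.d * P.L ^ K) + 24 * P.L ^ K := by ring
      rw [e1] at hh
      generalize P.L ^ K * K₀ = h at h8 hh ⊢
      generalize P.d * P.L ^ K = nd at hh ⊢
      omega
    -- the letter constant and its smallness
    set βK : ℝ := Cm / K₀ with hβK
    have hβK0 : 0 ≤ βK := div_nonneg hCm0.le hK₀r.le
    have hCβK : Cβ / K₀ ≤ βK := div_le_div_of_nonneg_right (le_max_left _ _) hK₀r.le
    have hCbK : Cb / K₀ ≤ βK := div_le_div_of_nonneg_right (le_max_right _ _) hK₀r.le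
    have hDβ : (3 : ℝ) ^ P.d * βK ≤ Real.exp (-1) := letter_small hK₀r hK₀C
    have h23 : (2 : ℝ) ^ P.d * βK < 1 := two_pow_mul_lt_one hβK0 hDβ
    -- the cube inputs at the interior cubes of `Ω` (inside `Ω₀`, where (2.23) holds)
    have hcj : ∀ j : Lab P K K₀, cube K K₀ j ⊆ Ω → _ := fun j hj =>
      hcubeK P hdd hPL1 K hK1 hK hK₀M hN3 a msq le_rfl le_rfl hmsq hcap j A ec hec (hle.trans (min_le_left _ _))
        (abs_acT_sub_le_of_reg_on hK hK₀M hK₀' C j A hec fun z hz μ ν => hreg z (hsub (hj hz)) μ ν)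
    have hdj : ∀ j : Lab P K K₀, cube K K₀ j ⊆ Ω → _ := fun j hj =>
      hderK P hdd hPL1 hK1 hK hK₀M hN3 hcap j A hec hle3 fun z hz μ' ν => hreg z (hsub (hj hz)) μ' ν
    have hhj : ∀ j : Lab P K K₀, cube K K₀ j ⊆ Ω → _ := fun j hj =>
      hholK P hdd hPL1 hK1 hK hK₀M hN3 hcap A hec hle4 j fun z hz μ' ν => hreg z (hsub (hj hz)) μ' ν
    -- the smallness `d²·c·e_K^β ≤ 1/3`
    have hsmall : (P.d : ℝ) ^ 2 * creg * ec ^ β ≤ 1 / 3 :=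
      smallness_third hcreg hβ hec (hle.trans (min_le_right _ _))
    -- the `L²` letter at every piece of a big-block region inside `Ω₀` (Lemma 2.1 at the boundary pieces, (2.21) inside)
    have h2gen : ∀ (Ω' : Finset (HiggsLattice.Site P 0)), IsBigBlockUnion K K₀ Ω' → Ω' ⊆ Ω₀ →
        ∀ (j : Lab P K K₀) (ψ : HiggsLattice.ScalarField P 0 N), (∀ y, y ∉ Ω' → ψ y = 0) →
          sNorm (bOp C K K₀ Ω' A msq a j ψ) ≤ βK * sNorm ψ := by
      intro Ω' hΩ' hsub' j ψ hψ
      have hreg' : ∀ z ∈ Ω', ∀ μ ν : Fin P.d,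
          P.mesh K * |C.e| / ec * |A ⟨z.shift ν, μ⟩ - A ⟨z, μ⟩| ≤ creg * ec ^ (β - 1) / (P.L : ℝ) ^ K :=
        fun z hz μ ν => hreg z (hsub' hz) ν μ
      by_cases hj : cube K K₀ j ⊆ Ω'
      · have hcj' := hcubeK P hdd hPL1 K hK1 hK hK₀M hN3 a msq le_rfl le_rfl hmsq hcap j A ec hec (hle.trans (min_le_left _ _))
          (abs_acT_sub_le_of_reg_on hK hK₀M hK₀' C j A hec fun z hz μ ν => hreg z (hsub' (hj hz)) μ ν)
        have h22 := hcj'.2.2.1 2 2 (by norm_num) le_rfl (by rw [sub_self]; positivity) ψ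
        have hc := cTwo_pos P K
        rw [lpT_two_eq, lpT_two_eq, mul_left_comm (Cβ / (K₀ : ℝ))] at h22
        have h3 := le_of_mul_le_mul_left h22 hc
        rw [bOp_of_good C Ω' A msq a hj ψ, ← neg_one_smul ℝ, sNorm_smul, abs_neg, abs_one, one_mul]
        exact h3.trans (mul_le_mul_of_nonneg_right hCβK (sNorm_nonneg _))
      · have hb := sNorm_bOp_le_of_bad C ha hL1 hmsq hK1 hK hK₀M hK₀8 hN3 hΩ' A hec hreg' hsmall hj ψ hψ
        refine hb.trans (mul_le_mul_of_nonneg_right (le_trans (le_of_eq ?_) hCbK) (sNorm_nonneg _))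
        rw [hCb, hγ₀, hPL, hdd]
    have h2Ω := h2gen Ω hΩ hsub
    have h2Ω₀ := h2gen Ω₀ hΩ₀ subset_rfl
    -- `R₀` around the four probe points; the distances from them
    have hshift : ∀ {s : ℕ} {z : HiggsLattice.Site P 0} {y : HiggsLattice.Site P 0}, s ≤ HiggsLattice.Site.tdist z y →
        s - 1 ≤ HiggsLattice.Site.tdist (z.shift μ) y := by
      intro s z y hs
      have h1 := tdist_shift_le_one z μ
      have h2 : (HiggsLattice.Site.tdist z y : ℝ) ≤ HiggsLattice.Site.tdist z (z.shift μ) + HiggsLattice.Site.tdist (z.shift μ) y :=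
        tdist_triangle_real _ _ _
      have h3 : HiggsLattice.Site.tdist z y ≤ HiggsLattice.Site.tdist z (z.shift μ) + HiggsLattice.Site.tdist (z.shift μ) y := by
        exact_mod_cast h2
      omega
    have hRshift : ∀ {z : HiggsLattice.Site P 0}, (∀ y, HiggsLattice.Site.tdist z y ≤ 2 * rS P K K₀ + 2 * half P K K₀ * (P.d + 1) + 1 → y ∈ Ω) →
        ∀ y, HiggsLattice.Site.tdist (z.shift μ) y ≤ 2 * rS P K K₀ + 2 * half P K K₀ * (P.d + 1) → y ∈ Ω := by
      intro z hRz y hy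
      apply hRz y
      have h1 := tdist_shift_le_one z μ
      have h2 : (HiggsLattice.Site.tdist z y : ℝ) ≤ HiggsLattice.Site.tdist z (z.shift μ) + HiggsLattice.Site.tdist (z.shift μ) y :=
        tdist_triangle_real _ _ _
      have h3 : HiggsLattice.Site.tdist z y ≤ HiggsLattice.Site.tdist z (z.shift μ) + HiggsLattice.Site.tdist (z.shift μ) y := by
        exact_mod_cast h2
      omega
    have hR : ∀ x'' ∈ ({x, x.shift μ, x', x'.shift μ} : Finset (HiggsLattice.Site P 0)), ∀ y,
        HiggsLattice.Site.tdist x'' y ≤ 2 * rS P K K₀ + 2 * half P K K₀ * (P.d + 1) → y ∈ Ω := by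
      intro x'' hx'' y hy
      simp only [Finset.mem_insert, Finset.mem_singleton] at hx''
      rcases hx'' with h | h | h | h
      · subst h; exact hRx y (by omega)
      · subst h; exact hRshift hRx y hy
      · subst h; exact hRx' y (by omega)
      · subst h; exact hRshift hRx' y hy
    have hfX : ∀ x'' ∈ ({x, x.shift μ, x', x'.shift μ} : Finset (HiggsLattice.Site P 0)), ∀ y, g y ≠ 0 →
        ⌈D⌉₊ - 1 ≤ HiggsLattice.Site.tdist x'' y := by
      intro x'' hx'' y hy
      simp only [Finset.mem_insert, Finset.mem_singleton] at hx''
      rcases hx'' with h | h | h | h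
      · subst h; have := Nat.ceil_le.2 (hDx y hy); omega
      · subst h; exact hshift (Nat.ceil_le.2 (hDx y hy))
      · subst h; have := Nat.ceil_le.2 (hDx' y hy); omega
      · subst h; exact hshift (Nat.ceil_le.2 (hDx' y hy))
    have hD₀X : ∀ x'' ∈ ({x, x.shift μ, x', x'.shift μ} : Finset (HiggsLattice.Site P 0)), ∀ z, z ∉ Ω →
        ⌈D₀⌉₊ - 1 ≤ HiggsLattice.Site.tdist x'' z := by
      intro x'' hx'' z hz
      simp only [Finset.mem_insert, Finset.mem_singleton] at hx''
      rcases hx'' with h | h | h | h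
      · subst h; have := Nat.ceil_le.2 (hxD₀ z hz); omega
      · subst h; exact hshift (Nat.ceil_le.2 (hxD₀ z hz))
      · subst h; have := Nat.ceil_le.2 (hx'D₀ z hz); omega
      · subst h; exact hshift (Nat.ceil_le.2 (hx'D₀ z hz))
    -- casts
    have hdd1 : ((dd P : ℝ) + 1) = (P.d : ℝ) := by
      rw [← dd_succ P]; push_cast; ring
    have hnR : ((((P.L - 1 + 1) ^ K : ℕ)) : ℝ) = (P.L : ℝ) ^ K := by
      rw [predL_succ, Nat.cast_pow]
    have hmeshK : P.mesh K = (P.L : ℝ) ^ K * P.mesh 0 := by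
      unfold HiggsLattice.Params.mesh; ring
    have hγT := gammaT_le (Pd := P.d) (K₀ := K₀) (CH := CH) (α := α) hK₀8 hD1 hD2 hCδ.le hCγ'.le hn0 hmesh0 ht1 htn
      (Nat.cast_nonneg l.length) hlen hα1
    have esub : ∀ a' b' c' d' : EuclideanSpace ℝ (Fin N), a' + b' - (c' + d') = (a' - c') + (b' - d') := fun _ _ _ _ => by abel
    have esub' : ∀ a' b' c' d' : EuclideanSpace ℝ (Fin N), a' - b' - (c' - d') = (a' - c') - (b' - d') := fun _ _ _ _ => by abel
    -- the joint remainder for the Hölder probe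
    have hCder : 0 ≤ 2 * ((P.mesh 0)⁻¹ * (2 * ((Real.sqrt (P.mesh 0 ^ P.d))⁻¹ * msq⁻¹ * sNorm g))) := by
      have := Real.sqrt_nonneg (P.mesh 0 ^ P.d)
      have := sNorm_nonneg g
      positivity
    have hremgen : ∀ (Ω' : Finset (HiggsLattice.Site P 0)),
        (∀ (j : Lab P K K₀) (ψ : HiggsLattice.ScalarField P 0 N), (∀ y, y ∉ Ω' → ψ y = 0) →
          sNorm (bOp C K K₀ Ω' A msq a j ψ) ≤ βK * sNorm ψ) →
        ∀ m : ℕ, ‖hol C A x l (covDeriv C A ((GP C K Ω' A msq a * RopP C K K₀ Ω' A msq a ^ m) g) ⟨x', μ⟩)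
            - covDeriv C A ((GP C K Ω' A msq a * RopP C K K₀ Ω' A msq a ^ m) g) ⟨x, μ⟩‖
          ≤ (2 ^ P.d * βK) ^ m * (2 * ((P.mesh 0)⁻¹ * (2 * ((Real.sqrt (P.mesh 0 ^ P.d))⁻¹ * msq⁻¹ * sNorm g)))) := by
      intro Ω' h2' m
      refine (norm_sub_le _ _).trans ?_
      rw [norm_hol_apply]
      have h1 := norm_covDeriv_tail_le C Ω' A hK hK₀M hK₀8 hmsq hak hβK0 h2' m g ⟨x', μ⟩
      have h2'' := norm_covDeriv_tail_le C Ω' A hK hK₀M hK₀8 hmsq hak hβK0 h2' m g ⟨x, μ⟩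
      linarith
    -- the cancellation of the two expansions with the Hölder probe
    have hmain := chain_region_diff_of_inputs_probe C Ω Ω₀ A hK hK₀M hK₀8 hN3 hΩ hΩ₀ hsub hmsq hak (n₀ := P.d) P.hd
      (γ := Cnear * (t / (P.L : ℝ) ^ K) ^ α * P.mesh K) (β := βK) (by positivity) hβK0 hDβ
      (Φ := fun w => ‖hol C A x l (covDeriv C A w ⟨x', μ⟩) - covDeriv C A w ⟨x, μ⟩‖)
      (by rw [covDeriv_zero', covDeriv_zero', map_zero, sub_zero, norm_zero])
      (fun u v => by
        show ‖hol C A x l (covDeriv C A (u + v) ⟨x', μ⟩) - covDeriv C A (u + v) ⟨x, μ⟩‖ ≤ _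
        rw [covDeriv_add', covDeriv_add', map_add, esub]
        exact norm_add_le _ _)
      (fun u v => by
        show ‖hol C A x l (covDeriv C A (u - v) ⟨x', μ⟩) - covDeriv C A (u - v) ⟨x, μ⟩‖ ≤ _
        rw [covDeriv_sub', covDeriv_sub', map_sub, esub']
        exact norm_sub_le _ _)
      ({x, x.shift μ, x', x'.shift μ} : Finset (HiggsLattice.Site P 0))
      (fun w hw => by
        show ‖hol C A x l (covDeriv C A w ⟨x', μ⟩) - covDeriv C A w ⟨x, μ⟩‖ ≤ 0
        rw [covDeriv_eq_zero_of_vanish C A w (hw x' (by simp)) (hw (x'.shift μ) (by simp)),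
          covDeriv_eq_zero_of_vanish C A w (hw x (by simp)) (hw (x.shift μ) (by simp)), map_zero, sub_zero, norm_zero])
      (fun i hi g' => by
        show ‖hol C A x l (covDeriv C A (aOp C K K₀ Ω A msq a i g') ⟨x', μ⟩) - covDeriv C A (aOp C K K₀ Ω A msq a i g') ⟨x, μ⟩‖
          ≤ Cnear * (t / (P.L : ℝ) ^ K) ^ α * P.mesh K * ‖g'‖
        rw [aOp_apply, Gloc_of_good C Ω A msq a hi]
        have hg' := norm_nonneg g'
        have hP := norm_probe_hsmul_le C hK hK₀M hK₀8 hN3 hroom i A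
          (propagatorK C (cube K K₀ i) (cubeVec K K₀ i A) msq a K (hTor K K₀ i • g'))
          (γ0 := Cγ' * P.mesh K ^ 2 * ‖g'‖) (γD := Cδ * P.mesh K * ‖g'‖) (γH := CH * (t / (P.L : ℝ) ^ K) ^ α * P.mesh K * ‖g'‖)
          (by positivity) (by positivity) (by positivity) μ hch hend hlen hnt
          (fun y => (norm_le_pi_norm _ y).trans ((hdj i hi).1 g')) (fun y ν hy hs => (hdj i hi).2.1 g' y ν hy hs)
          (fun h1 h2 h3 h4 h5 => hhj i hi g' μ x x' l h1 h2 h3 h4 hne hch hend h5 hlen)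
        refine hP.trans ?_
        rw [hdd1, hnR, hmeshK]
        have e1 : CH * (t / (P.L : ℝ) ^ K) ^ α * ((P.L : ℝ) ^ K * P.mesh 0) * ‖g'‖
            + (P.d : ℝ) * (D1 hprof + D2 hprof) / K₀ * ((2 * l.length + 2) / (P.L : ℝ) ^ K) * (Cδ * ((P.L : ℝ) ^ K * P.mesh 0) * ‖g'‖)
            + (D1 hprof ^ 2 + D2 hprof) / (K₀ : ℝ) ^ 2 * ((P.d : ℝ) * l.length / (((P.L : ℝ) ^ K) ^ 2 * P.mesh 0))
              * (Cγ' * ((P.L : ℝ) ^ K * P.mesh 0) ^ 2 * ‖g'‖)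
            = (CH * (t / (P.L : ℝ) ^ K) ^ α * ((P.L : ℝ) ^ K * P.mesh 0)
              + (P.d : ℝ) * (D1 hprof + D2 hprof) / K₀ * ((2 * l.length + 2) / (P.L : ℝ) ^ K) * (Cδ * ((P.L : ℝ) ^ K * P.mesh 0))
              + (D1 hprof ^ 2 + D2 hprof) / (K₀ : ℝ) ^ 2 * ((P.d : ℝ) * l.length / (((P.L : ℝ) ^ K) ^ 2 * P.mesh 0))
                * (Cγ' * ((P.L : ℝ) ^ K * P.mesh 0) ^ 2)) * ‖g'‖ := by ring
        rw [e1]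
        calc _ ≤ (Cnear * (t / (P.L : ℝ) ^ K) ^ α * ((P.L : ℝ) ^ K * P.mesh 0)) * ‖g'‖ := by
              rw [hCnear]; exact mul_le_mul_of_nonneg_right hγT hg'
          _ = _ := by ring)
      (fun j hj ψ => by
        rw [bOp_of_good C Ω A msq a hj ψ, norm_neg]
        exact ((hcj j hj).2.1 ψ).trans (mul_le_mul_of_nonneg_right hCβK (norm_nonneg _)))
      (fun j hj p q h1p hpq hdiff ψ => by
        rw [bOp_of_good C Ω A msq a hj ψ, lpT_neg]
        exact ((hcj j hj).2.2.1 p q h1p hpq hdiff ψ).trans (mul_le_mul_of_nonneg_right hCβK (lpT_nonneg _ _)))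
      (fun j hj ψ => by
        rw [bOp_of_good C Ω A msq a hj ψ, norm_neg]
        exact ((hcj j hj).2.2.2 (2 * P.d) le_rfl ψ).trans (mul_le_mul_of_nonneg_right hCβK (lpT_nonneg _ _)))
      h2Ω h2Ω₀ hR g (Dist := ⌈D⌉₊ - 1) (D₀ := ⌈D₀⌉₊ - 1) (D₁ := ⌈D₁⌉₊) hfX hD₀X
      (fun y hy z hz => Nat.ceil_le.2 (hgD₁ y z hy hz))
      (V := 1) le_rfl (by rw [one_mul]; exact lpT_two_le_of_blockK hK y₀ hg)
      (exists_sum_le_of_geometric (by positivity) h23 hCder hCder (hremgen Ω h2Ω) (hremgen Ω₀ h2Ω₀))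
    have hcard : (({x, x.shift μ, x', x'.shift μ} : Finset (HiggsLattice.Site P 0)).card : ℝ) ≤ 4 := by
      have h := Finset.card_le_four (a := x) (b := x.shift μ) (c := x') (d := x'.shift μ)
      exact_mod_cast h
    have hw : ((t / (P.L : ℝ) ^ K)⁻¹) ^ α * (t / (P.L : ℝ) ^ K) ^ α = 1 := by
      rw [Real.inv_rpow hq0.le, inv_mul_cancel₀ (Real.rpow_pos_of_pos hq0 α).ne']
    have hQ : Q ≤ 4 * (4 * 2 ^ P.d) * (Cnear * (t / (P.L : ℝ) ^ K) ^ α * P.mesh K) * (Real.exp 3 * E) * M := by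
      refine hmain.trans ?_
      calc 4 * ((({x, x.shift μ, x', x'.shift μ} : Finset (HiggsLattice.Site P 0)).card : ℝ) * 2 ^ P.d)
            * (Cnear * (t / (P.L : ℝ) ^ K) ^ α * P.mesh K) * 1
            * Real.exp (-((((((⌈D⌉₊ - 1) + (⌈D₀⌉₊ - 1) + ⌈D₁⌉₊ : ℕ)) : ℝ) - 8 * rS P K K₀ - 4 * half P K K₀) / (4 * half P K K₀))) * ‖g‖
          ≤ 4 * (4 * 2 ^ P.d) * (Cnear * (t / (P.L : ℝ) ^ K) ^ α * P.mesh K) * 1 * (Real.exp 3 * E) * M := by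
            refine mul_le_mul (mul_le_mul ?_ hexp (by positivity) (by positivity)) hgn (norm_nonneg _) (by positivity)
            have h1 : (({x, x.shift μ, x', x'.shift μ} : Finset (HiggsLattice.Site P 0)).card : ℝ) * 2 ^ P.d ≤ 4 * 2 ^ P.d :=
              mul_le_mul_of_nonneg_right hcard (by positivity)
            have h2 : 4 * ((({x, x.shift μ, x', x'.shift μ} : Finset (HiggsLattice.Site P 0)).card : ℝ) * 2 ^ P.d) ≤ 4 * (4 * 2 ^ P.d) :=
              mul_le_mul_of_nonneg_left h1 (by norm_num)
            exact mul_le_mul_of_nonneg_right (mul_le_mul_of_nonneg_right h2 (by positivity)) zero_le_one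
        _ = _ := by ring
    calc ((t / (P.L : ℝ) ^ K)⁻¹) ^ α * Q
        ≤ ((t / (P.L : ℝ) ^ K)⁻¹) ^ α * (4 * (4 * 2 ^ P.d) * (Cnear * (t / (P.L : ℝ) ^ K) ^ α * P.mesh K) * (Real.exp 3 * E) * M) :=
          mul_le_mul_of_nonneg_left hQ (Real.rpow_nonneg (inv_nonneg.2 hq0.le) α)
      _ = (((t / (P.L : ℝ) ^ K)⁻¹) ^ α * (t / (P.L : ℝ) ^ K) ^ α) * (16 * 2 ^ P.d * Cnear * Real.exp 3 * P.mesh K * E * M) := by ring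
      _ = 16 * 2 ^ P.d * Cnear * Real.exp 3 * P.mesh K * E * M := by rw [hw, one_mul]
      _ ≤ (16 * 2 ^ P.d * Cnear * Real.exp 3 + 2 * c₉) * P.mesh K * E * M := by
          have hle1 : 16 * 2 ^ P.d * Cnear * Real.exp 3 ≤ 16 * 2 ^ P.d * Cnear * Real.exp 3 + 2 * c₉ := by linarith
          exact mul_le_mul_of_nonneg_right (mul_le_mul_of_nonneg_right (mul_le_mul_of_nonneg_right hle1 hmesh.le) hE0) hM0
  · -- the regime `|x − x′| > L^K`: «a simple consequence of the corresponding inequality for the derivative only»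
    have htn : (P.L : ℝ) ^ K < t := by
      rw [ht_def]; exact_mod_cast (not_le.1 hnt)
    have hw1 : ((t / (P.L : ℝ) ^ K)⁻¹) ^ α ≤ 1 :=
      Real.rpow_le_one (inv_nonneg.2 hq0.le) (inv_le_one_of_one_le₀ ((one_le_div hn0).2 htn.le)) hα0
    have h1 := hfar' x' hRx' hDx' hx'D₀
    have h2 := hfar' x hRx hDx hxD₀
    have hQ : Q ≤ 2 * c₉ * P.mesh K * E * M := by
      refine (norm_sub_le _ _).trans ?_
      rw [norm_hol_apply]
      have h1' : ‖covDeriv C A δG ⟨x', μ⟩‖ ≤ c₉ * P.mesh K * E * M := h1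
      have h2' : ‖covDeriv C A δG ⟨x, μ⟩‖ ≤ c₉ * P.mesh K * E * M := h2
      linarith
    calc ((t / (P.L : ℝ) ^ K)⁻¹) ^ α * Q ≤ 1 * Q := mul_le_mul_of_nonneg_right hw1 hQ0
      _ ≤ 2 * c₉ * P.mesh K * E * M := by rw [one_mul]; exact hQ
      _ ≤ (16 * 2 ^ P.d * Cnear * Real.exp 3 + 2 * c₉) * P.mesh K * E * M := by
          have hle2 : 2 * c₉ ≤ 16 * 2 ^ P.d * Cnear * Real.exp 3 + 2 * c₉ := by
            have : 0 ≤ 16 * 2 ^ P.d * Cnear * Real.exp 3 := by positivity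
            linarith
          exact mul_le_mul_of_nonneg_right (mul_le_mul_of_nonneg_right (mul_le_mul_of_nonneg_right hle2 hmesh.le) hE0) hM0

end Main

/-! ## §3 Summation over the `K`-blocks: arbitrary `g` -/

section Sum

variable {K : ℕ}

set_option maxHeartbeats 1600000 in
/-- **PROP. 2.1 (2.26) WITH (2.24), HÖLDER MEMBER OF THE `δG` CLAUSE, FOR BIG-BLOCK REGIONS `Ω ⊆ Ω₀` AT EVERY (2.23)-REGULAR FIELD,
ARBITRARY `g`** — B4's THEOREM (1.11)–(1.12) WITH (1.9) FOR REGIONS ON THE CARRIER in the operator form of gens 10–12: same data as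
`holder_deltaG_region_reg_decay`; `K₀min` before `α`, then for every `0 ≤ α < 1` and `K₀ ≥ K₀min` constants `c₀(K₀), e₁(K₀) > 0` such that …
for EVERY `g` with `‖g‖_∞ ≤ M′` vanishing within `D` of `x` and of `x′`, `x, x′` at distance `≥ D₀` and `supp g` at distance `≥ D₁` from `Ω^c`:
`(|x − x′|/L^K)^{−α}·‖U(A(Γ))(D^ε_A δG g)(⟨x′, μ⟩) − (D^ε_A δG g)(⟨x, μ⟩)‖ ≤ c₀(K₀)(L^Kε)·exp(−(D + D₀ + D₁)/(8K₀L^K))·M′`.  Proof: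
`g = Σ_b g|_{B^K(b)}`, the Hölder probe is subadditive, each piece is within the previous theorem with
`D_b = max(D, L^K(min(|x_K − b|, |x′_K − b|) − 1))`, and `Σ_b (e^{−|x_K − b|/(8K₀)} + e^{−|x′_K − b|/(8K₀)}) ≤ 2K_d(1/(8K₀))`.
[cite: Balaban1982Higgs1, Prop. 2.1 (2.24), (2.26) pp.610–611] [cite: Balaban1983RegularityDecay, Theorem (1.11)–(1.12) p.573; §2 ¶1 pp.574–575; p.579] -/
theorem holder_deltaG_region_reg_decay_sum (d L : ℕ) (hd : 1 ≤ d) (hL : 2 ≤ L) {a : ℝ} (ha : 0 < a) {msq : ℝ}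
    (hmsq : 0 < msq) (N : ℕ) (C : ChargeData N) (ε₀ : ℝ) (creg β : ℝ) (hcreg : 0 ≤ creg) (hβ : 0 < β) :
    ∃ K₀min : ℕ, ∀ {α : ℝ}, 0 ≤ α → α < 1 → ∀ K₀ : ℕ, K₀min ≤ K₀ → ∃ c₀ e₁ : ℝ, 0 < c₀ ∧ 0 < e₁ ∧
      ∀ (P : HiggsLattice.Params), P.d = d → P.L = L → K₀ ∣ P.M →
      ∀ {K : ℕ}, 1 ≤ K → K ≤ P.K → (∀ μ, 3 * half P K K₀ ≤ P.sitesPerDir 0 μ) → P.mesh K ≤ ε₀ →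
      ∀ (Ω Ω₀ : Finset (HiggsLattice.Site P 0)), IsBigBlockUnion K K₀ Ω → IsBigBlockUnion K K₀ Ω₀ → Ω ⊆ Ω₀ →
      ∀ (A : HiggsLattice.VecField P 0) {ec : ℝ}, 0 < ec → ec ≤ e₁ →
      (∀ z ∈ Ω₀, ∀ μ ν : Fin P.d,
          P.mesh K * |C.e| / ec * |A ⟨z.shift μ, ν⟩ - A ⟨z, ν⟩| ≤ creg * ec ^ (β - 1) / (P.L : ℝ) ^ K) →
      ∀ (μ : Fin P.d) (x x' : HiggsLattice.Site P 0), x' ≠ x →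
        (∀ y, HiggsLattice.Site.tdist x y ≤ 2 * rS P K K₀ + 2 * half P K K₀ * (P.d + 1) + 1 → y ∈ Ω) →
        (∀ y, HiggsLattice.Site.tdist x' y ≤ 2 * rS P K K₀ + 2 * half P K K₀ * (P.d + 1) + 1 → y ∈ Ω) →
        ∀ (l : List (HiggsLattice.Site P 0)), IsTChain x l → pathEnd x l = x' →
          (l.length : ℝ) ≤ (P.d : ℝ) * HiggsLattice.Site.tdist x x' →
        ∀ (g : HiggsLattice.ScalarField P 0 N) (M D D₀ D₁ : ℝ), (∀ y, ‖g y‖ ≤ M) → 0 ≤ D → 0 ≤ D₀ → 0 ≤ D₁ →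
          (∀ z, g z ≠ 0 → D ≤ (HiggsLattice.Site.tdist x z : ℝ)) → (∀ z, g z ≠ 0 → D ≤ (HiggsLattice.Site.tdist x' z : ℝ)) →
          (∀ z, z ∉ Ω → D₀ ≤ (HiggsLattice.Site.tdist x z : ℝ)) → (∀ z, z ∉ Ω → D₀ ≤ (HiggsLattice.Site.tdist x' z : ℝ)) →
          (∀ y z, g y ≠ 0 → z ∉ Ω → D₁ ≤ (HiggsLattice.Site.tdist z y : ℝ)) →
            (((HiggsLattice.Site.tdist x x' : ℝ) / (P.L : ℝ) ^ K)⁻¹) ^ α *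
                ‖hol C A x l (covDeriv C A (propagatorK C Ω A msq a K (chi Ω • g) - propagatorK C Ω₀ A msq a K (chi Ω₀ • g)) ⟨x', μ⟩)
                  - covDeriv C A (propagatorK C Ω A msq a K (chi Ω • g) - propagatorK C Ω₀ A msq a K (chi Ω₀ • g)) ⟨x, μ⟩‖
              ≤ c₀ * P.mesh K * Real.exp (-((D + D₀ + D₁) / (8 * K₀ * (P.L : ℝ) ^ K))) * M := by
  obtain ⟨K₀min, hmain⟩ := holder_deltaG_region_reg_decay d L hd hL ha hmsq N C ε₀ creg β hcreg hβ
  refine ⟨max K₀min 1, fun {α} hα0 hα1 K₀ hK₀ => ?_⟩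
  obtain ⟨c₀, hc₀, hmainα⟩ := hmain hα0 hα1
  have hK₀1 : 1 ≤ K₀ := le_trans (le_max_right _ _) hK₀
  have hK₀r : (0 : ℝ) < K₀ := by exact_mod_cast hK₀1
  obtain ⟨e₁, he₁, hblk⟩ := hmainα K₀ (le_trans (le_max_left _ _) hK₀)
  have hrate : (0 : ℝ) < 1 / (8 * K₀) := by positivity
  have hlc : 0 < latticeConst d (1 / (8 * K₀)) := by
    unfold latticeConst
    apply pow_pos
    have hdr : (0 : ℝ) < d := by exact_mod_cast hd
    have h1 : Real.exp (-(1 / (8 * (K₀ : ℝ)) / d)) < 1 := Real.exp_lt_one_iff.2 (by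
      have := div_pos hrate hdr; linarith)
    have h2 : 0 < 1 - Real.exp (-(1 / (8 * (K₀ : ℝ)) / d)) := by linarith
    positivity
  refine ⟨c₀ * Real.exp (1 / (8 * K₀)) * (2 * latticeConst d (1 / (8 * K₀))), e₁, by positivity, he₁, ?_⟩
  intro P hPd hPL hK₀M K hK1 hK hN3 hε Ω Ω₀ hΩ hΩ₀ hsub A ec hec hle hreg μ x x' hne hRx hRx' l hch hend hlen g M D D₀ D₁ hgM hD0 hD₀0 hD₁0
    hDx hDx' hxD₀ hx'D₀ hgD₁
  subst hPd
  have hmK0 : 0 < P.mesh K := P.mesh_pos K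
  have hM0 : 0 ≤ M := (norm_nonneg _).trans (hgM x)
  have hLK : (0 : ℝ) < (P.L : ℝ) ^ K := pow_pos (by exact_mod_cast P.hL) K
  set w : ℝ := (((HiggsLattice.Site.tdist x x' : ℝ) / (P.L : ℝ) ^ K)⁻¹) ^ α with hw_def
  have hw0 : 0 ≤ w := Real.rpow_nonneg (inv_nonneg.2 (div_nonneg (Nat.cast_nonneg _) hLK.le)) α
  -- the difference operator as a function of the source
  set dG : HiggsLattice.ScalarField P 0 N → HiggsLattice.ScalarField P 0 N :=
    fun u => propagatorK C Ω A msq a K (chi Ω • u) - propagatorK C Ω₀ A msq a K (chi Ω₀ • u) with hdG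
  have hdG_sum : dG g = ∑ b : HiggsLattice.Site P K, dG (blockPiece K b g) := by
    simp only [hdG]
    conv_lhs => rw [← sum_blockPiece (K := K) g]
    rw [Finset.smul_sum, Finset.smul_sum, map_sum, map_sum, ← Finset.sum_sub_distrib]
  -- split `g` over the `K`-blocks; the probe is subadditive
  have esub : ∀ (s : Finset (HiggsLattice.Site P K)) (u : HiggsLattice.Site P K → HiggsLattice.ScalarField P 0 N),
      ‖hol C A x l (covDeriv C A (∑ b ∈ s, u b) ⟨x', μ⟩) - covDeriv C A (∑ b ∈ s, u b) ⟨x, μ⟩‖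
        ≤ ∑ b ∈ s, ‖hol C A x l (covDeriv C A (u b) ⟨x', μ⟩) - covDeriv C A (u b) ⟨x, μ⟩‖ := by
    intro s u
    rw [covDeriv_sum', covDeriv_sum', map_sum, ← Finset.sum_sub_distrib]
    exact norm_sum_le _ _
  have hsplit : ‖hol C A x l (covDeriv C A (dG g) ⟨x', μ⟩) - covDeriv C A (dG g) ⟨x, μ⟩‖
      ≤ ∑ b : HiggsLattice.Site P K, ‖hol C A x l (covDeriv C A (dG (blockPiece K b g)) ⟨x', μ⟩)
        - covDeriv C A (dG (blockPiece K b g)) ⟨x, μ⟩‖ := by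
    rw [hdG_sum]
    exact esub _ _
  -- the weight of the block `b`
  set wt : HiggsLattice.Site P K → ℝ := fun b =>
    Real.exp (-((D + D₀ + D₁) / (8 * K₀ * (P.L : ℝ) ^ K))) * Real.exp (1 / (8 * K₀))
      * (Real.exp (-(1 / (8 * K₀) * (HiggsLattice.Site.tdist (blockIter K x) b : ℝ)))
        + Real.exp (-(1 / (8 * K₀) * (HiggsLattice.Site.tdist (blockIter K x') b : ℝ)))) with hwt
  -- each block piece: the previous theorem with `D_b = max D (L^K(min(|x_K − b|, |x′_K − b|) − 1))`
  have hpiece : ∀ b : HiggsLattice.Site P K,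
      w * ‖hol C A x l (covDeriv C A (dG (blockPiece K b g)) ⟨x', μ⟩) - covDeriv C A (dG (blockPiece K b g)) ⟨x, μ⟩‖
        ≤ c₀ * P.mesh K * wt b * M := by
    intro b
    classical
    by_cases hb : ∃ y₀, blockIter K y₀ = b
    · obtain ⟨y₀, hy₀⟩ := hb
      set tm : ℝ := min (HiggsLattice.Site.tdist (blockIter K x) b : ℝ) (HiggsLattice.Site.tdist (blockIter K x') b : ℝ) with htm
      set Db : ℝ := max D ((P.L : ℝ) ^ K * (tm - 1)) with hDb
      have hDb0 : 0 ≤ Db := hD0.trans (le_max_left _ _)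
      have hfarz : ∀ z₀ : HiggsLattice.Site P 0, tm ≤ (HiggsLattice.Site.tdist (blockIter K z₀) b : ℝ) →
          (∀ z, g z ≠ 0 → D ≤ (HiggsLattice.Site.tdist z₀ z : ℝ)) →
          ∀ z, blockPiece K b g z ≠ 0 → Db ≤ (HiggsLattice.Site.tdist z₀ z : ℝ) := by
        intro z₀ htm' hDz z hz
        have hzb : blockIter K z = b := by
          by_contra h
          exact hz (by unfold blockPiece; rw [if_neg h])
        have hgz : g z ≠ 0 := fun h0 => hz (by unfold blockPiece; rw [if_pos hzb, h0])
        refine max_le (hDz z hgz) ?_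
        have h1 := tdist_blockIter_le_real hK z₀ z
        rw [hzb] at h1
        have h2 : (P.L : ℝ) ^ K * (HiggsLattice.Site.tdist (blockIter K z₀) b : ℝ)
            ≤ (P.L : ℝ) ^ K * ((HiggsLattice.Site.tdist z₀ z : ℝ) / (P.L : ℝ) ^ K + 1 - ((P.L : ℝ) ^ K)⁻¹) :=
          mul_le_mul_of_nonneg_left h1 hLK.le
        have e : (P.L : ℝ) ^ K * ((HiggsLattice.Site.tdist z₀ z : ℝ) / (P.L : ℝ) ^ K + 1 - ((P.L : ℝ) ^ K)⁻¹)
            = (HiggsLattice.Site.tdist z₀ z : ℝ) + (P.L : ℝ) ^ K - 1 := by field_simp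
        rw [e] at h2
        have h3 : (P.L : ℝ) ^ K * (tm - 1) ≤ (P.L : ℝ) ^ K * ((HiggsLattice.Site.tdist (blockIter K z₀) b : ℝ) - 1) :=
          mul_le_mul_of_nonneg_left (by linarith) hLK.le
        rw [mul_sub, mul_one] at h3
        linarith
      have hgD₁' : ∀ y z, blockPiece K b g y ≠ 0 → z ∉ Ω → D₁ ≤ (HiggsLattice.Site.tdist z y : ℝ) := by
        intro y z hy hz
        have hyb : blockIter K y = b := by
          by_contra h
          exact hy (by unfold blockPiece; rw [if_neg h])
        have hgy : g y ≠ 0 := fun h0 => hy (by unfold blockPiece; rw [if_pos hyb, h0])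
        exact hgD₁ y z hgy hz
      have h := hblk P rfl hPL hK₀M hK1 hK hN3 hε Ω Ω₀ hΩ hΩ₀ hsub A hec hle hreg μ x x' hne hRx hRx' l hch hend hlen y₀ (blockPiece K b g)
        M Db D₀ D₁ (blockPiece_supported b g hy₀) (fun y => (norm_blockPiece_apply_le b g y).trans (hgM y)) hDb0 hD₀0 hD₁0
        (hfarz x (min_le_left _ _) hDx) (hfarz x' (min_le_right _ _) hDx') hxD₀ hx'D₀ hgD₁'
      refine h.trans (mul_le_mul_of_nonneg_right (mul_le_mul_of_nonneg_left ?_ (by positivity)) hM0)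
      -- `e^{−(D_b + D₀ + D₁)/(4K₀L^K)} ≤ e^{−(D + D₀ + D₁)/(8K₀L^K)}·e^{1/(8K₀)}·(e^{−|x_K − b|/(8K₀)} + e^{−|x′_K − b|/(8K₀)})`
      have hK4 : (0 : ℝ) < 4 * K₀ * (P.L : ℝ) ^ K := by positivity
      have hK8 : (0 : ℝ) < 8 * K₀ * (P.L : ℝ) ^ K := by positivity
      have hmax : D + (P.L : ℝ) ^ K * (tm - 1) ≤ 2 * Db := by rw [two_mul]; exact add_le_add (le_max_left _ _) (le_max_right _ _)
      have key : (D + (P.L : ℝ) ^ K * (tm - 1) + 2 * (D₀ + D₁)) / (8 * K₀ * (P.L : ℝ) ^ K) ≤ (Db + D₀ + D₁) / (4 * K₀ * (P.L : ℝ) ^ K) :=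
        calc (D + (P.L : ℝ) ^ K * (tm - 1) + 2 * (D₀ + D₁)) / (8 * K₀ * (P.L : ℝ) ^ K)
            ≤ (2 * Db + 2 * (D₀ + D₁)) / (8 * K₀ * (P.L : ℝ) ^ K) := div_le_div_of_nonneg_right (by linarith) hK8.le
          _ = (Db + D₀ + D₁) / (4 * K₀ * (P.L : ℝ) ^ K) := by field_simp; ring
      have e1 : (D + (P.L : ℝ) ^ K * (tm - 1) + 2 * (D₀ + D₁)) / (8 * K₀ * (P.L : ℝ) ^ K)
          = (D + D₀ + D₁) / (8 * K₀ * (P.L : ℝ) ^ K) - 1 / (8 * K₀) + 1 / (8 * K₀) * tm + (D₀ + D₁) / (8 * K₀ * (P.L : ℝ) ^ K) := by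
        field_simp
        ring
      rw [e1] at key
      have hpos : 0 ≤ (D₀ + D₁) / (8 * K₀ * (P.L : ℝ) ^ K) := div_nonneg (by linarith) hK8.le
      have hstep : Real.exp (-((Db + D₀ + D₁) / (4 * K₀ * (P.L : ℝ) ^ K)))
          ≤ Real.exp (-((D + D₀ + D₁) / (8 * K₀ * (P.L : ℝ) ^ K))) * Real.exp (1 / (8 * K₀)) * Real.exp (-(1 / (8 * K₀) * tm)) := by
        rw [← Real.exp_add, ← Real.exp_add]
        exact Real.exp_le_exp.2 (by linarith)
      rw [hwt]
      refine hstep.trans (mul_le_mul_of_nonneg_left ?_ (by positivity))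
      rcases min_choice (HiggsLattice.Site.tdist (blockIter K x) b : ℝ) (HiggsLattice.Site.tdist (blockIter K x') b : ℝ) with h | h
      · rw [htm, h]; exact le_add_of_nonneg_right (Real.exp_pos _).le
      · rw [htm, h]; exact le_add_of_nonneg_left (Real.exp_pos _).le
    · -- no site maps to `b`: the piece vanishes
      have h0 : blockPiece K b g = 0 := by
        funext y
        unfold blockPiece
        rw [if_neg (fun h => hb ⟨y, h⟩)]
        rfl
      have hwt0 : 0 ≤ wt b := by rw [hwt]; positivity
      have hdG0 : dG (blockPiece K b g) = 0 := by
        simp only [hdG]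
        rw [h0, smul_zero, smul_zero, map_zero, map_zero, sub_zero]
      rw [hdG0, covDeriv_zero', covDeriv_zero', map_zero, sub_zero, norm_zero, mul_zero]
      positivity
  have hsumx := sum_exp_neg_tdist_le (P := P) (k := K) hrate (blockIter K x)
  have hsumx' := sum_exp_neg_tdist_le (P := P) (k := K) hrate (blockIter K x')
  have hwsum : ∑ b : HiggsLattice.Site P K, wt b
      ≤ Real.exp (-((D + D₀ + D₁) / (8 * K₀ * (P.L : ℝ) ^ K))) * Real.exp (1 / (8 * K₀)) * (2 * latticeConst P.d (1 / (8 * K₀))) := by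
    rw [hwt, ← Finset.mul_sum, Finset.sum_add_distrib]
    exact mul_le_mul_of_nonneg_left (by linarith) (by positivity)
  calc w * ‖hol C A x l (covDeriv C A (dG g) ⟨x', μ⟩) - covDeriv C A (dG g) ⟨x, μ⟩‖
      ≤ w * ∑ b : HiggsLattice.Site P K, ‖hol C A x l (covDeriv C A (dG (blockPiece K b g)) ⟨x', μ⟩)
        - covDeriv C A (dG (blockPiece K b g)) ⟨x, μ⟩‖ := mul_le_mul_of_nonneg_left hsplit hw0
    _ = ∑ b : HiggsLattice.Site P K, w * ‖hol C A x l (covDeriv C A (dG (blockPiece K b g)) ⟨x', μ⟩)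
        - covDeriv C A (dG (blockPiece K b g)) ⟨x, μ⟩‖ := by rw [Finset.mul_sum]
    _ ≤ ∑ b : HiggsLattice.Site P K, c₀ * P.mesh K * wt b * M := Finset.sum_le_sum fun b _ => hpiece b
    _ = c₀ * P.mesh K * (∑ b : HiggsLattice.Site P K, wt b) * M := by rw [← Finset.sum_mul, ← Finset.mul_sum]
    _ ≤ c₀ * P.mesh K * (Real.exp (-((D + D₀ + D₁) / (8 * K₀ * (P.L : ℝ) ^ K))) * Real.exp (1 / (8 * K₀))
          * (2 * latticeConst P.d (1 / (8 * K₀)))) * M :=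
        mul_le_mul_of_nonneg_right (mul_le_mul_of_nonneg_left hwsum (by positivity)) hM0
    _ = c₀ * Real.exp (1 / (8 * K₀)) * (2 * latticeConst P.d (1 / (8 * K₀))) * P.mesh K
          * Real.exp (-((D + D₀ + D₁) / (8 * K₀ * (P.L : ℝ) ^ K))) * M := by ring

end Sum

end Literature.MathematicalPhysics.QuantumFieldTheory.Balaban1983to89.B1Ineq226HolderRegularRegion

end
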